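import Literature.Analysis.FluidPDE.SereginSverakBlowupCompactnessProofs
import Literature.Analysis.FluidPDE.SereginSverakBlowupCore
import Literature.Analysis.FluidPDE.LocalTypeIScaling
import Literature.Analysis.FluidPDE.ClassicalSolutionRescale
import Literature.Analysis.FluidPDE.CKN1982Setting
import HarnessLib

/-!
# Route HardyPointSink — `HardyAncientLimit`, step 2: near-maximum centres and the rescaled fields

Support file for item stmt-NavierStokesRegularity-9138 (`HardyAncientLimit`) of route
`HardyPointSink` (problem `NavierStokesRegularity`).

The blow-up procedure of Seregin–Šverák 2009, §4 (arXiv:0804.1803, p. 11; = Seregin 2014, §6.5),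
in the general (non-axisymmetric) setting of a velocity field `v` on the unit cylinder
`Q = 𝒞(1) × ]-1, 0[` which is continuous there and singular at the space–time origin:

* `HardyAncientLimit.exists_centres` — the weighted near-maximum selection of the tree
  (`SereginSverak2009.exists_centre`) run for every `N = k + 1`: centres `z_k ∈ Q(1/8)`, sizes
  `0 < d_k ≤ 1/10` with `(k + 1) ≤ ‖v(z_k)‖ d_k`, the doubling bound `‖v‖ ≤ 2‖v(z_k)‖` on the
  backward cylinder of size `d_k/2` about `z_k`, that cylinder inside `Q(1/8)`;
* the rescaled fields `U = c v ∘ Φ`, `Φ(s, y) = (t_k + c² s, x_k + c y)`, centred AT `z_k` (not on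
  an axis): `Φ` maps `𝒞(R) × ]-R², 0]` into the backward cylinder when `c R ≤ d_k/2`
  (`stAffine_mem_backCyl_of_mem_parCylTop`), whence the bound `‖U‖ ≤ 1` for `c = 1/(2‖v(z_k)‖)`
  (`norm_rescaled_le_one`), continuity up to `s = 0` (`continuousOn_rescaled`), the distributional
  equations on `Q(0, R)` for a distributional pair on the parabolic ball `Q(0, 1)`
  (`isDistributional_rescaled`), and smoothness of the rescaled velocity on a neighbourhood of
  `[-R², 0]` (`icc_subset_preimage_time`);
* geometry between the bi-cylinders `𝒞`, `Q(z, R)` of Seregin–Šverák and the parabolic balls of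
  Caffarelli–Kohn–Nirenberg, and the transport of a backward singular point under the zoom
  (`not_isRegularAtOrigin_of_eLpNorm_eq_top`, `eLpNorm_zoom_parabolicCylinder_eq_top`).

## References

* G. Seregin, V. Šverák, Comm. PDE 34 (2009) = arXiv:0804.1803, §4 p. 11.
* G. Koch, N. Nadirashvili, G. Seregin, V. Šverák, Acta Math. 203 (2009), §6 (6.2)–(6.3).
* D. Albritton, T. Barker, arXiv:1811.00502, §3 (forward direction of Thm. 1.1).
-/

noncomputable section

open Literature.Analysis.FluidPDE Literature.Analysis.FluidPDE.SereginSverak2009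
open MeasureTheory Set Function Filter Topology Metric TopologicalSpace
open scoped ENNReal NNReal

namespace Summit.NavierStokesRegularity.NavierStokesRegularity.Theorems

namespace HardyAncientLimit

/-! ### Geometry: coordinates, bi-cylinders and parabolic balls -/

/-- `|x₃| ≤ ‖x‖` in `ℝ³` (`‖x‖² = |x'|² + x₃²`). [folklore] -/
theorem abs_apply_two_le_norm (x : EuclideanSpace ℝ (Fin 3)) : |x 2| ≤ ‖x‖ := by
  refine abs_le_of_sq_le_sq ?_ (norm_nonneg x)
  have h := norm_sq_eq_cylRadius_sq_add x
  nlinarith [sq_nonneg (cylRadius x)]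

/-- A ball lies in the coaxial bi-cylinder of the same centre and radius: `B(x₀, R) ⊆ 𝒞(x₀, R)`.
[folklore] -/
theorem ball_subset_spaceCyl (x₀ : EuclideanSpace ℝ (Fin 3)) (R : ℝ) :
    ball x₀ R ⊆ spaceCyl x₀ R := by
  intro x hx
  rw [mem_ball, dist_eq_norm] at hx
  rw [mem_spaceCyl]
  refine ⟨(cylRadius_le_norm' _).trans_lt hx, ?_⟩
  have h2 : |(x - x₀) 2| ≤ ‖x - x₀‖ := abs_apply_two_le_norm _
  rw [PiLp.sub_apply] at h2
  exact h2.trans_lt hx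

/-- A parabolic ball lies in the Seregin–Šverák cylinder of the same vertex and radius:
`Q(z₀, R) ⊆ 𝒞(x₀, R) × ]t₀ - R², t₀[`. [folklore] -/
theorem parabolicCylinder_subset_parCyl (z₀ : ℝ × EuclideanSpace ℝ (Fin 3)) (R : ℝ) :
    parabolicCylinder R z₀ ⊆ parCyl z₀ R := by
  intro z hz
  rw [mem_parabolicCylinder] at hz
  exact ⟨hz.1, ball_subset_spaceCyl _ _ (mem_ball.2 hz.2)⟩

/-- The bi-cylinder `𝒞(R)` lies in the ball `B(0, 2R)` (`‖x‖ ≤ |x'| + |x₃|`). [folklore] -/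
theorem spaceCyl_zero_subset_ball (R : ℝ) :
    spaceCyl (0 : EuclideanSpace ℝ (Fin 3)) R ⊆ ball 0 (2 * R) := by
  intro x hx
  rw [mem_spaceCyl] at hx
  simp only [sub_zero, PiLp.zero_apply] at hx
  rw [mem_ball_zero_iff]
  calc ‖x‖ ≤ cylRadius x + |x 2| := norm_le_cylRadius_add_abs x
    _ < R + R := add_lt_add hx.1 hx.2
    _ = 2 * R := by ring

/-- `Q(0, R) ⊆` the parabolic ball of radius `2R` at the origin (`R ≥ 0`). [folklore] -/
theorem parCyl_zero_subset_parabolicCylinder (R : ℝ) :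
    parCyl (0 : ℝ × EuclideanSpace ℝ (Fin 3)) R ⊆ parabolicCylinder (2 * R) 0 := by
  intro z hz
  rw [mem_parCyl_zero] at hz
  rw [mem_parabolicCylinder]
  simp only [Prod.fst_zero, Prod.snd_zero, zero_sub, dist_zero_right]
  refine ⟨⟨by nlinarith [hz.1.1], hz.1.2⟩, ?_⟩
  have h := spaceCyl_zero_subset_ball R ((mem_spaceCyl).2 (by simpa using hz.2))
  rwa [mem_ball_zero_iff] at h

/-! ### Singular points: the origin is not regular -/

/-- A velocity field which is essentially unbounded on every parabolic ball `Q(0, r)` at the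
origin is not regular at the origin in the sense of Seregin–Šverák (essentially unbounded on every
`Q(0, r) = 𝒞(r) × ]-r², 0[`, which contains the ball). [folklore] -/
theorem not_isRegularAtOrigin_of_eLpNorm_eq_top
    {v : ℝ → EuclideanSpace ℝ (Fin 3) → EuclideanSpace ℝ (Fin 3)}
    (h : ∀ r : ℝ, 0 < r →
      eLpNorm (uncurry v) ∞ (volume.restrict (parabolicCylinder r (0 : ℝ × EuclideanSpace ℝ (Fin 3)))) = ∞) :
    ¬ IsRegularAtOrigin v := by
  rintro ⟨r, hr, hfin⟩
  have hle : eLpNorm (uncurry v) ∞ (volume.restrict (parabolicCylinder r (0 : ℝ × EuclideanSpace ℝ (Fin 3)))) ≤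
      eLpNorm (uncurry v) ∞ (volume.restrict (parCyl 0 r)) :=
    eLpNorm_mono_measure _ (Measure.restrict_mono (parabolicCylinder_subset_parCyl 0 r) le_rfl)
  rw [h r hr] at hle
  exact lt_irrefl _ (hle.trans_lt hfin)

/-- **A backward singular point is transported to the origin by the zoom.** If `u` is essentially
unbounded on every parabolic ball `Q((T, xs), r)`, then its zoom `ρ u(T + ρ² s, xs + ρ y)`,
`ρ > 0`, is essentially unbounded on every `Q(0, r)` (`L^∞` norms scale by `ρ`,
`eLpNorm_top_nsZoom`). [folklore] -/
theorem eLpNorm_zoom_parabolicCylinder_eq_top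
    {u : ℝ → EuclideanSpace ℝ (Fin 3) → EuclideanSpace ℝ (Fin 3)} {T ρ : ℝ}
    {xs : EuclideanSpace ℝ (Fin 3)} (hρ : 0 < ρ)
    (h : ∀ r : ℝ, 0 < r →
      eLpNorm (uncurry u) ∞ (volume.restrict (parabolicCylinder r ((T, xs) : ℝ × EuclideanSpace ℝ (Fin 3)))) = ∞)
    {r : ℝ} (hr : 0 < r) :
    eLpNorm (uncurry (ρ • stPull (ρ ^ 2) ρ T xs u)) ∞
      (volume.restrict (parabolicCylinder r (0 : ℝ × EuclideanSpace ℝ (Fin 3)))) = ∞ := by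
  rw [eLpNorm_top_nsZoom hρ T xs r 0 u]
  have h0 : stAffine (ρ ^ 2) ρ T xs (0 : ℝ × EuclideanSpace ℝ (Fin 3)) = (T, xs) := by
    rw [show (0 : ℝ × EuclideanSpace ℝ (Fin 3)) = ((0 : ℝ), (0 : EuclideanSpace ℝ (Fin 3))) from rfl,
      stAffine_apply]
    simp
  rw [h0, h (ρ * r) (mul_pos hρ hr)]
  exact ENNReal.mul_top (by simpa using hρ)

/-! ### The near-maximum centres -/

/-- **The centres of the blow-up** (Seregin–Šverák 2009, §4, selection of `x_k, t_k, M_k`,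
through the tree's weighted selection `SereginSverak2009.exists_centre` run at `N = k + 1`): for a
velocity field `v` continuous on `Q = 𝒞(1) × ]-1, 0[` and not regular at the origin, there are
centres `z_k ∈ Q(1/8)` and sizes `0 < d_k ≤ 1/10` with `k + 1 ≤ ‖v(z_k)‖ d_k`, the doubling
bound `‖v‖ ≤ 2‖v(z_k)‖` on the backward cylinder of size `d_k/2` about `z_k`, and that cylinder
inside `Q(1/8)`. -/
theorem exists_centres {v : ℝ → EuclideanSpace ℝ (Fin 3) → EuclideanSpace ℝ (Fin 3)}
    (hcont : ContinuousOn (uncurry v) (parCyl 0 1)) (hsing : ¬ IsRegularAtOrigin v) :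
    ∃ (zc : ℕ → ℝ × EuclideanSpace ℝ (Fin 3)) (d : ℕ → ℝ), ∀ k : ℕ,
      zc k ∈ parCyl 0 (1 / 8) ∧ 0 < d k ∧ d k ≤ 1 / 10 ∧
      ((k : ℝ) + 1) ≤ ‖uncurry v (zc k)‖ * d k ∧
      (∀ z ∈ backCyl (zc k) (d k / 2), ‖uncurry v z‖ ≤ 2 * ‖uncurry v (zc k)‖) ∧
      backCyl (zc k) (d k / 2) ⊆ parCyl 0 (1 / 8) := by
  have hsel : ∀ k : ℕ, ∃ z₀ : ℝ × EuclideanSpace ℝ (Fin 3), ∃ d : ℝ,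
      z₀ ∈ parCyl 0 (1 / 8) ∧ |z₀.2 2| ≤ 1 / 10 ∧ 0 < d ∧ d ≤ 1 / 10 ∧
      ((k : ℝ) + 1) ≤ ‖uncurry v z₀‖ * d ∧
      (∀ z ∈ backCyl z₀ (d / 2), ‖uncurry v z‖ ≤ 2 * ‖uncurry v z₀‖) ∧
      backCyl z₀ (d / 2) ⊆ parCyl 0 (1 / 8) := fun k =>
    exists_centre (u := v) (v := uncurry v) hcont EventuallyEq.rfl hsing (by positivity)
  choose zc d h1 _ h3 h4 h5 h6 h7 using hsel
  exact ⟨zc, d, fun k => ⟨h1 k, h3 k, h4 k, h5 k, h6 k, h7 k⟩⟩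

/-! ### The rescaled fields about one centre -/

section Rescale

variable {v : ℝ → EuclideanSpace ℝ (Fin 3) → EuclideanSpace ℝ (Fin 3)}
  {zk : ℝ × EuclideanSpace ℝ (Fin 3)} {σ c R : ℝ}

/-- **`Φ` maps `𝒞(R) × ]-R², 0]` into the backward cylinder of size `σ` about `z_k`** when
`c R ≤ σ`, `Φ(s, y) = (t_k + c² s, x_k + c y)` (`c > 0`, `R ≥ 0`). [folklore] -/
theorem stAffine_mem_backCyl_of_mem_parCylTop (hc : 0 < c) (hR : 0 ≤ R) (hcR : c * R ≤ σ)
    {z : ℝ × EuclideanSpace ℝ (Fin 3)} (hz : z ∈ parCylTop R) :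
    stAffine (c ^ 2) c zk.1 zk.2 z ∈ backCyl zk σ := by
  rw [mem_parCylTop, mem_spaceCyl] at hz
  obtain ⟨⟨ht1, ht2⟩, hr, ha⟩ := hz
  simp only [sub_zero, PiLp.zero_apply] at hr ha
  have hc2 : 0 < c ^ 2 := pow_pos hc 2
  have hcR0 : 0 ≤ c * R := mul_nonneg hc.le hR
  have hσ2 : c ^ 2 * R ^ 2 ≤ σ ^ 2 := by
    calc c ^ 2 * R ^ 2 = (c * R) ^ 2 := by ring
      _ ≤ σ ^ 2 := pow_le_pow_left₀ hcR0 hcR 2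
  rw [mem_backCyl]
  simp only [stAffine_fst, stAffine_snd, add_sub_cancel_left, PiLp.add_apply, PiLp.smul_apply,
    smul_eq_mul, add_sub_cancel_left]
  refine ⟨⟨?_, ?_⟩, ?_, ?_⟩
  · have : -(c ^ 2 * R ^ 2) < c ^ 2 * z.1 := by nlinarith
    linarith
  · nlinarith
  · rw [cylRadius_smul, abs_of_pos hc]
    calc c * cylRadius z.2 < c * R := mul_lt_mul_of_pos_left hr hc
      _ ≤ σ := hcR
  · rw [abs_mul, abs_of_pos hc]
    calc c * |z.2 2| < c * R := mul_lt_mul_of_pos_left ha hc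
      _ ≤ σ := hcR

/-- **The bound on the rescaled velocity** (KNSS 2009, (6.3); Seregin–Šverák 2009, (p5)): if
`‖v‖ ≤ B` on the backward cylinder of size `σ` about `z_k`, `c B ≤ 1` and `c R ≤ σ`, then
`‖c v(t_k + c² s, x_k + c y)‖ ≤ 1` on `𝒞(R) × ]-R², 0]`. -/
theorem norm_rescaled_le_one (hc : 0 < c) (hR : 0 ≤ R) (hcR : c * R ≤ σ) {B : ℝ}
    (hbd : ∀ z ∈ backCyl zk σ, ‖uncurry v z‖ ≤ B) (hcB : c * B ≤ 1)
    {z : ℝ × EuclideanSpace ℝ (Fin 3)} (hz : z ∈ parCylTop R) :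
    ‖(c • stPull (c ^ 2) c zk.1 zk.2 v) z.1 z.2‖ ≤ 1 := by
  have h := hbd _ (stAffine_mem_backCyl_of_mem_parCylTop hc hR hcR hz)
  rw [stAffine_apply, uncurry_apply_pair] at h
  rw [smul_stPull_apply, norm_smul, Real.norm_eq_abs, abs_of_pos hc]
  calc c * ‖v (zk.1 + c ^ 2 * z.1) (zk.2 + c • z.2)‖ ≤ c * B := mul_le_mul_of_nonneg_left h hc.le
    _ ≤ 1 := hcB

/-- **Continuity of the rescaled velocity up to `s = 0`** on `𝒞(R) × ]-R², 0]`, when `v` is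
continuous on `Q` and the backward cylinder of size `σ ≥ c R` about `z_k` lies in `Q`
(Seregin–Šverák 2009, §4, (p3) and (p11)). -/
theorem continuousOn_rescaled (hcont : ContinuousOn (uncurry v) (parCyl 0 1)) (hc : 0 < c)
    (hR : 0 ≤ R) (hcR : c * R ≤ σ) (hσ : backCyl zk σ ⊆ parCyl 0 1) :
    ContinuousOn (uncurry (c • stPull (c ^ 2) c zk.1 zk.2 v)) (parCylTop R) := by
  have hmaps : MapsTo (stAffine (c ^ 2) c zk.1 zk.2) (parCylTop R) (parCyl 0 1) := fun z hz =>
    hσ (stAffine_mem_backCyl_of_mem_parCylTop hc hR hcR hz)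
  have h := (hcont.comp (continuous_stAffine _ _ _ _).continuousOn hmaps).const_smul c
  exact h.congr fun z _ => rfl

/-- **The rescaled pair solves Navier–Stokes in `Q(0, R)`** (Seregin–Šverák 2009, §4: "these
functions satisfy the Navier–Stokes equations in `Q(M_k)`"): if `(v, q)` is a distributional
solution (`ν = 1`, no force) on the parabolic ball `Q(0, 1)` and the backward cylinder of size
`σ ≥ c R` about `z_k` lies in `Q(1/8)`, then `(c v ∘ Φ, c² q ∘ Φ)` is a distributional solution on
`Q(0, R) = 𝒞(R) × ]-R², 0[`. -/
theorem isDistributional_rescaled {q : ℝ → EuclideanSpace ℝ (Fin 3) → ℝ}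
    (h : IsDistributionalNSSolutionOn (parabolicCylinderOpens 1 (0 : ℝ × EuclideanSpace ℝ (Fin 3))) 1 0 v q)
    (hc : 0 < c) (hR : 0 ≤ R) (hcR : c * R ≤ σ) (hσ : backCyl zk σ ⊆ parCyl 0 (1 / 8)) :
    IsDistributionalNSSolutionOn (parCylOpens 0 R) 1 0 (c • stPull (c ^ 2) c zk.1 zk.2 v)
      (c ^ 2 • stPull (c ^ 2) c zk.1 zk.2 q) := by
  have h1 := h.stRescale hc hc (show c ^ 2 = c * c by ring) zk.1 zk.2
  have hν : c * 1 / c = 1 := by field_simp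
  have hf : (c ^ 2 * c) • stPull (c ^ 2) c zk.1 zk.2
      (0 : ℝ → EuclideanSpace ℝ (Fin 3) → EuclideanSpace ℝ (Fin 3)) = 0 := by
    funext s y
    simp [stPull]
  rw [hν, hf] at h1
  refine h1.of_le fun z hz => ?_
  rw [mem_stPreimage]
  have hz' : z ∈ parCylTop R := parCyl_zero_subset_parCylTop R hz
  have h8 := hσ (stAffine_mem_backCyl_of_mem_parCylTop hc hR hcR hz')
  have h14 : parCyl (0 : ℝ × EuclideanSpace ℝ (Fin 3)) (1 / 8) ⊆ parabolicCylinder 1 0 :=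
    (parCyl_zero_subset_parabolicCylinder (1 / 8)).trans
      (parabolicCylinder_mono (by norm_num) (by norm_num) 0)
  exact h14 h8

/-- **Times of the rescaled window stay inside `]-1, 0[`**: if `z_k ∈ Q(1/8)` and
`c R ≤ σ ≤ 1/20`, `0 < c ≤ 1/20`, then `t_k + c² s ∈ ]-1, 0[` for every
`s ∈ ]-R² - 1/2, -t_k/c²[` — an open interval containing `[-R², 0]` (as `t_k < 0`). [folklore] -/
theorem ioo_subset_preimage_time (hzk : zk ∈ parCyl (0 : ℝ × EuclideanSpace ℝ (Fin 3)) (1 / 8))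
    (hc : 0 < c) (hc1 : c ≤ 1 / 20) (hR : 0 ≤ R) (hcR : c * R ≤ σ) (hσ : σ ≤ 1 / 20) :
    Ioo (-(R ^ 2) - 1 / 2) (-zk.1 / c ^ 2) ⊆ (fun s => zk.1 + c ^ 2 * s) ⁻¹' Ioo (-1 : ℝ) 0 := by
  intro s hs
  rw [mem_parCyl_zero] at hzk
  obtain ⟨⟨ht1, _⟩, -, -⟩ := hzk
  have hc2 : 0 < c ^ 2 := pow_pos hc 2
  have hc2' : c ^ 2 ≤ 1 / 400 := by nlinarith
  have hcR2 : c ^ 2 * R ^ 2 ≤ 1 / 400 := by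
    have hcR0 : 0 ≤ c * R := mul_nonneg hc.le hR
    calc c ^ 2 * R ^ 2 = (c * R) ^ 2 := by ring
      _ ≤ (1 / 20) ^ 2 := pow_le_pow_left₀ hcR0 (hcR.trans hσ) 2
      _ = 1 / 400 := by norm_num
  rw [mem_preimage, mem_Ioo]
  constructor
  · have h1 : c ^ 2 * (-(R ^ 2) - 1 / 2) < c ^ 2 * s := mul_lt_mul_of_pos_left hs.1 hc2
    nlinarith
  · have h2 : c ^ 2 * s < c ^ 2 * (-zk.1 / c ^ 2) := mul_lt_mul_of_pos_left hs.2 hc2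
    rw [mul_div_cancel₀ _ hc2.ne'] at h2
    linarith

/-- The right end `-t_k/c²` of that interval is positive (`t_k < 0`). [folklore] -/
theorem neg_time_div_sq_pos (hzk : zk ∈ parCyl (0 : ℝ × EuclideanSpace ℝ (Fin 3)) (1 / 8))
    (hc : 0 < c) : 0 < -zk.1 / c ^ 2 := by
  rw [mem_parCyl_zero] at hzk
  exact div_pos (by linarith [hzk.1.2]) (pow_pos hc 2)

/-- **Smoothness of the rescaled velocity near `[-R², 0]`.** If `v` is jointly smooth on
`]-1, 0[ × ℝ³`, then `c v(t_k + c² ·, x_k + c ·)` is jointly smooth on `]-R² - 1/2, -t_k/c²[ × ℝ³`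
under the hypotheses of `ioo_subset_preimage_time` (smooth on `]-R² - 1/2, -t_k/c²[ × ℝ³`). [folklore] -/
theorem isSmoothSpaceTimeOn_rescaled (hv : IsSmoothSpaceTimeOn (Ioo (-1 : ℝ) 0) v)
    (hzk : zk ∈ parCyl (0 : ℝ × EuclideanSpace ℝ (Fin 3)) (1 / 8))
    (hc : 0 < c) (hc1 : c ≤ 1 / 20) (hR : 0 ≤ R) (hcR : c * R ≤ σ) (hσ : σ ≤ 1 / 20) :
    IsSmoothSpaceTimeOn (Ioo (-(R ^ 2) - 1 / 2) (-zk.1 / c ^ 2))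
      (c • stPull (c ^ 2) c zk.1 zk.2 v) :=
  (hv.smul_stPull c (c ^ 2) c zk.1 zk.2).mono (ioo_subset_preimage_time hzk hc hc1 hR hcR hσ)

/-! ### The scalars of the `k`-th rescaling -/

/-- **Bookkeeping of the scales.** With `M = ‖v(z_k)‖`, `0 < d ≤ 1/10` and `k + 1 ≤ M d`:
`M > 0`, the scale `c = 1/(2M)` is positive with `c (2M) = 1`, `c ≤ 1/20`, the radius
`R = M d` satisfies `k + 1 ≤ R` and `c R = d/2 ≤ 1/20`. [folklore] -/
theorem scales_of_centre {M d : ℝ} {k : ℕ} (hd : 0 < d) (hd1 : d ≤ 1 / 10)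
    (hN : (k : ℝ) + 1 ≤ M * d) :
    0 < M ∧ 0 < 1 / (2 * M) ∧ 1 / (2 * M) * (2 * M) = 1 ∧ 1 / (2 * M) ≤ 1 / 20 ∧
      (k : ℝ) + 1 ≤ M * d ∧ 1 / (2 * M) * (M * d) = d / 2 ∧ d / 2 ≤ 1 / 20 := by
  have hk : (0 : ℝ) ≤ k := Nat.cast_nonneg k
  have hM : 0 < M := by
    by_contra h
    push Not at h
    have : M * d ≤ 0 := mul_nonpos_of_nonpos_of_nonneg h hd.le
    linarith
  have hM10 : 10 ≤ M := by
    have h1 : 1 ≤ M * d := by linarith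
    by_contra h
    push Not at h
    have : M * d < 10 * (1 / 10) := by nlinarith
    linarith
  refine ⟨hM, by positivity, by field_simp, ?_, hN, by field_simp, by linarith⟩
  exact one_div_le_one_div_of_le (by norm_num) (by linarith)

end Rescale

end HardyAncientLimit

end Summit.NavierStokesRegularity.NavierStokesRegularity.Theorems

end
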